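import Summits.QuantumFields.YangMills.Theses.UnitScaleTilt
import Literature.MathematicalPhysics.QuantumFieldTheory.Balaban1983to89.T3AveragedTailProfile

/-!
# Route `UnitScaleTilt` — crux K2 `HistoryTail` (stmt-QuantumFields-18916), birth v3: the registered stub
# `stub_tailOfPerPlaquette` PROVED (support file; K2 itself stays open)

Cell `ym3-torus` (HUMAN RULING D-0037, YM ladder rung R3), seat `ym3-torus-p2` gen 7.  The route owner's BC3 birth v3 of K2
(`HOME/route-R3/ym/plan-g10/HistoryTail_birth_v3.lean`, registered 2026-08-26T06:16Z) splits the block-AVERAGED heights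
`T3BareTailProfile.AveragedTailAt` into a PER-PLAQUETTE, PER-HEIGHT large-field Gibbs tail with a cutoff-uniform constant
(`stub_perPlaquetteOfAlpha`, XL, the located unprinted content of K2, given Bałaban's (α) package) and the BOOKKEEPING
`stub_tailOfPerPlaquette` (M): per-plaquette schema ⇒ `AveragedTailAt F γ b₀ p₀` for `0 < γ ≤ 1`, `0 < b₀`, `1 ≤ p₀`.  The latter is
the tree theorem `T3AveragedTailProfile.averagedTailAt_of_perPlaquette` (union bound over the `≤ 9·(2L^{m+K−j})³` plaquettes of height
`j` along the `j`-fold averaging, `β_i^A = γ^{−A}L^{iA}`, `p(g_i) ≥ ½b₀ i log L`, completing the square; profile `A'·2^{−i}`); here it is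
restated with the REGISTERED SIGNATURE VERBATIM (`stub_tailOfPerPlaquette`) and packaged in the route's quantifier shape
(`unitScaleTilt_historyTail_of_perPlaquette`: K2 ⇐ for every admissible `L` a profile, a threshold `γ₁ ≤ 1` and the per-plaquette
tail for every family with `F.L = L`).  NOT a proof of K2.
-/

noncomputable section

open Literature.MathematicalPhysics.QuantumFieldTheory.Balaban1983to89
open Literature.MathematicalPhysics.QuantumFieldTheory.Balaban1983to89.T3ContinuumYM3Torus
open Literature.MathematicalPhysics.QuantumFieldTheory.Balaban1983to89.T3UnitScaleTilt
open Literature.MathematicalPhysics.QuantumFieldTheory.Balaban1983to89.T3UnitLawDensityEML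
open Literature.MathematicalPhysics.QuantumFieldTheory.Balaban1983to89.T3CruxEstimates
open Literature.MathematicalPhysics.QuantumFieldTheory.Balaban1983to89.T3BareTailProfile
open Literature.MathematicalPhysics.QuantumFieldTheory.Balaban1983to89.T3AveragedTailProfile
open Summit.QuantumFields.YangMills.Theses.UnitScaleTilt

namespace Summit.QuantumFields.YangMills.Theorems

/-- **REGISTERED STUB `stub_tailOfPerPlaquette` OF K2's BIRTH v3, PROVED** (signature verbatim): for every family `F`, coupling
`0 < γ ≤ 1` and profile `0 < b₀`, `1 ≤ p₀`, a per-plaquette, per-height large-field Gibbs tail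
`Gibbs_K{U : θ(K−j) ≤ |Ū^{j}(∂p) − 1|} ≤ C·β_{K−j}^A·exp(−c·p(g_{K−j})²)` (`C ≥ 0`, `A : ℕ`, `c > 0`; all `K`, `1 ≤ j ≤ K`, `p`)
implies `AveragedTailAt F γ b₀ p₀` — `T3AveragedTailProfile.averagedTailAt_of_perPlaquette`. -/
theorem stub_tailOfPerPlaquette :
    ∀ (F : T3Family) (γ b₀ p₀ : ℝ), 0 < γ → γ ≤ 1 → 0 < b₀ → 1 ≤ p₀ →
      (∃ (C : ℝ) (A : ℕ) (c : ℝ), 0 ≤ C ∧ 0 < c ∧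
          ∀ (K j : ℕ), 1 ≤ j → j ≤ K → ∀ p : Plaq (F.P K) j,
            (gibbsK F ℰp γ K).real
                {U | θBal F.L γ b₀ p₀ (K - j) ≤
                  GaugeGroup.dist1 (GaugeField.plaqHol
                    (Averaging.iter (fun i => BlockAveraging.blockAvg (P := F.P K) (j := i) ℰp) j U) p)} ≤
              C * (F.scheme ℰp γ).β (K - j) ^ A *
                Real.exp (-(c * B10.pFun b₀ p₀ (Real.sqrt (γ * ((F.L : ℝ)⁻¹) ^ (K - j))) ^ 2))) →
        AveragedTailAt F γ b₀ p₀ :=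
  fun F _ _ _ hγ hγ1 hb hp h => averagedTailAt_of_perPlaquette F hγ hγ1 hb hp h

/-- **K2 ⇐ THE PER-PLAQUETTE TAIL ALONE, in the route's quantifier shape**: for every `L` a profile `(b₀, p₀)` (`0 < b₀`,
`2 < p₀`), a threshold `0 < γ₁ ≤ 1`, and for every family with `F.L = L` and `0 < γ ≤ γ₁` the per-plaquette, per-height tail
(`stub_perPlaquetteOfAlpha`'s conclusion) give `HistoryTail` at EVERY free top fraction `1/m` (bare height: `bareTailAt`; averaged
heights: `stub_tailOfPerPlaquette`). -/
theorem unitScaleTilt_historyTail_of_perPlaquette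
    (h : ∀ L : ℕ, ∃ b₀ p₀ γ₁ : ℝ, 0 < b₀ ∧ 2 < p₀ ∧ 0 < γ₁ ∧ γ₁ ≤ 1 ∧
      ∀ (F : T3Family) (γ : ℝ), F.L = L → 0 < γ → γ ≤ γ₁ →
        ∃ (C : ℝ) (A : ℕ) (c : ℝ), 0 ≤ C ∧ 0 < c ∧
          ∀ (K j : ℕ), 1 ≤ j → j ≤ K → ∀ p : Plaq (F.P K) j,
            (gibbsK F ℰp γ K).real
                {U | θBal F.L γ b₀ p₀ (K - j) ≤
                  GaugeGroup.dist1 (GaugeField.plaqHol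
                    (Averaging.iter (fun i => BlockAveraging.blockAvg (P := F.P K) (j := i) ℰp) j U) p)} ≤
              C * (F.scheme ℰp γ).β (K - j) ^ A *
                Real.exp (-(c * B10.pFun b₀ p₀ (Real.sqrt (γ * ((F.L : ℝ)⁻¹) ^ (K - j))) ^ 2))) :
    HistoryTail := by
  intro L m hm
  obtain ⟨b₀, p₀, γ₁, hb, hp, hγ₁, hγ₁1, h⟩ := h L
  exact ⟨b₀, p₀, γ₁, hb, hp, hγ₁, fun F γ hL hγ hle =>
    historyTailAt_of_perPlaquette F hγ (hle.trans hγ₁1) hb (by linarith) hm (h F γ hL hγ hle)⟩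

end Summit.QuantumFields.YangMills.Theorems

end
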